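import Summits.Schanuel.Schanuel.Theses.MatrixCoefficients
import Literature.Barriers.Schanuel.AlgebraicIndependenceOfLogarithmsRankProofs
import Summits.Schanuel.Schanuel.Statement
import HarnessLib


/-!
# RootDecomp1 — ISOTROPY SIEVE on the first genuine stratum of piece D
(cell decomp-schanuel · lens-1 «grading / quantitative ladder» · g21 · route `route-Schanuel-RootDecomp1`,
piece D = `DisjointSaturatedEssentialSchanuel`, stmt-Schanuel-30353; the sieve's ONE registered input is
`Summit.Schanuel.Schanuel.Theses.MatrixCoefficients.MatrixCoefficientThree` = stmt-Schanuel-15346,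
Dasgupta–Kakde's Matrix Coefficient Conjecture at `N = 3` — open, printed, strictly inside the log sector
and never before attached to piece D)

The v4 residue of piece D starts with Cell(2,0) on NON-RATIONAL surfaces: a `ℚ`-linearly independent
triple `z = (z₀, z₁, z₂)` of logarithms of algebraic numbers on an ELLIPTIC CONE `{F = 0}`, `F` a smooth
ternary cubic form over `ℚ` (lens-1 g19/g20).  Lens-1 g20 PLACED the `ℚ`-determinantal such cones
(`F = det (X₀A₀ + X₁A₁ + X₂A₂)`, `Aₖ ∈ M₃(ℚ)`) on Roy's rank ladder.  This file GRADES them by the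
ARITHMETIC of the cubic and DECIDES one class modulo `MatrixCoefficientThree` (MC3):

* `det_ne_zero_of_mc3` — **the sieve.**  If the rational tensor `A = (A₀, A₁, A₂)` has NO RATIONAL
  ISOTROPIC PAIR (no `w, v ∈ ℚ³ ∖ {0}` with `wᵗ Aₖ v = 0` for `k = 0, 1, 2`), then MC3 implies: no
  `ℚ`-linearly independent `z ∈ ℂ³` with `e^{z₀}, e^{z₁}, e^{z₂}` algebraic lies on the cubic cone
  `det (∑ zₖ Aₖ) = 0`.  (The bilinear form `wᵗ M v` of `M = ∑ zₖ Aₖ` is `∑ₖ (wᵗAₖv) zₖ`, a RATIONAL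
  linear relation among the `zₖ`.)
* `isotropicPair_of_ratPoint`, `ratPoint_of_isotropicPair` — **exact reach.**  A rational isotropic
  pair exists iff the cone has a non-zero RATIONAL POINT `x ∈ ℚ³`, `det (∑ xₖ Aₖ) = 0` (elementary
  left/right-kernel linear algebra).  So the sieve empties exactly the `ℚ`-determinantal cones over plane
  cubics WITHOUT rational points (index-3 genus-one curves), and says nothing on cones over cubics with
  a rational point — in particular nothing on g20's congruent-number pencil (`congruentPencil_isotropic`:
  its entry `(0,1)` vanishes identically) nor on any `E(ℚ) ≠ ∅` family; for `N × N` pencils with `N ≥ 4`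
  in three variables an isotropic pair always exists, so the sieve is specific to degree `3` = the first
  stratum.
* `sievePencil`, `det_sievePencil`, `no_isotropic_pair_sievePencil` — **an explicit pointless cell.**
  `L(X) = [[X₀, X₁, X₂], [X₂, −X₀, −2X₁], [X₁, 4X₂, X₀]]`, `det L = −X₀³ − 2X₁³ + 4X₂³ + 8X₀X₁X₂`, the cone
  over the smooth plane cubic `x³ + 2y³ − 4z³ − 8xyz = 0`; its isotropy face has determinant
  `G(w) = w₀³ + 2w₁³ + 4w₂³ + 8w₀w₁w₂`, which has no non-trivial rational zero by 2-adic descent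
  (`int_descent`, `rat_descent`), hence (`sieveCone_free_of_mc3`) MC3 ALONE empties this cell of the v4
  first stratum: piece D and Schanuel's inequality hold there vacuously (`schanuel_ineq_on_sieveCone_of_mc3`).
* `sieveCone_free_of_schanuel` — S-side pin: Schanuel's conjecture empties the same cell (through the
  tree's `algIndepLogarithms_of_schanuel`), so the decided statement is on-path.

Honest label (NODE-g21): a DECISION of an explicit sub-class of D's first stratum MODULO ONE registered
open statement below `S` (MC3, stmt-Schanuel-15346, itself inside the barrier
`Literature/Barriers/Schanuel/AlgebraicIndependenceOfLogarithms.lean` as every log-sector statement is),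
not an unconditional theorem about logarithms; unconditional content = the descent, the isotropy/rational
point equivalence and the reduction.  Nothing is asserted as an axiom: MC3 and `Schanuel` occur only as
hypotheses.
-/

namespace Summit.Schanuel.Schanuel.Theorems.RootDecomp1IsotropySieve

open Literature.Barriers.Schanuel
open Summit.Schanuel.Schanuel.Theses.MatrixCoefficients (MatrixCoefficientThree)

/-! ## The bilinear form of a rational pencil at a point -/

/-- The entries of `∑ₖ zₖ Aₖ` (`Aₖ` rational) lie in Roy's `𝓛 = logQSpan` when every `e^{zₖ}` is
algebraic (repeated from lens-1 g20 for self-containedness). [cite: Roy1995, §1 (Preliminaries)] -/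
private theorem sum_smul_map_mem_logQSpan {n d l : ℕ} {z : Fin n → ℂ}
    (halg : ∀ k, IsAlgebraic ℚ (Complex.exp (z k))) (A : Fin n → Matrix (Fin d) (Fin l) ℚ)
    (i : Fin d) (j : Fin l) :
    (∑ k, z k • (A k).map (algebraMap ℚ ℂ)) i j ∈ logQSpan := by
  simp only [Matrix.sum_apply, Matrix.smul_apply, Matrix.map_apply, smul_eq_mul]
  refine Submodule.sum_mem _ fun k _ => ?_
  have hk : z k ∈ logQSpan := Submodule.subset_span (halg k)
  have : z k * algebraMap ℚ ℂ (A k i j) = (A k i j) • z k := by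
    rw [Algebra.smul_def, mul_comm]
  rw [this]
  exact Submodule.smul_mem _ _ hk

/-- `wᵗ (∑ₖ zₖ Aₖ) v = ∑ₖ (wᵗ Aₖ v) • zₖ` for rational `w, v`: the matrix coefficient of a member of a
rational pencil is a RATIONAL linear form in the pencil coordinates. [folklore] -/
theorem bilinear_sum_smul_eq (A : Fin 3 → Matrix (Fin 3) (Fin 3) ℚ) (z : Fin 3 → ℂ)
    (w v : Fin 3 → ℚ) :
    ∑ i, ∑ j, (w i : ℂ) * (∑ k, z k • (A k).map (algebraMap ℚ ℂ)) i j * (v j : ℂ) =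
      ∑ k, (∑ i, ∑ j, w i * A k i j * v j : ℚ) • z k := by
  simp only [Fin.sum_univ_three, Matrix.sum_apply, Matrix.smul_apply, Matrix.map_apply,
    smul_eq_mul, eq_ratCast, Rat.smul_def]
  push_cast
  ring

/-! ## The isotropy sieve -/

/-- **ISOTROPY SIEVE.**  Let `A₀, A₁, A₂ ∈ M₃(ℚ)` have no rational isotropic pair (`wᵗ Aₖ v = 0` for all
`k` forces `w = 0` or `v = 0`).  Then the Matrix Coefficient Conjecture for `3 × 3` matrices
(`MatrixCoefficientThree`, stmt-Schanuel-15346) implies that no `ℚ`-linearly independent `z ∈ ℂ³` with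
`e^{z₀}, e^{z₁}, e^{z₂}` algebraic lies on the cubic cone `det (∑ zₖ Aₖ) = 0`: the matrix `M = ∑ zₖ Aₖ` has
entries in `𝓛`, so MC3 gives non-zero rational `w, v` with `wᵗMv = ∑ₖ (wᵗAₖv) zₖ = 0`, and the `ℚ`-linear
independence of `z` forces `wᵗAₖv = 0` for every `k`. [cite: DasguptaKakde2024, Conjecture 1.2] -/
theorem det_ne_zero_of_mc3 (hMC : MatrixCoefficientThree) (A : Fin 3 → Matrix (Fin 3) (Fin 3) ℚ)
    (hA : ∀ w v : Fin 3 → ℚ, (∀ k, ∑ i, ∑ j, w i * A k i j * v j = 0) → w = 0 ∨ v = 0)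
    (z : Fin 3 → ℂ) (hz : LinearIndependent ℚ z) (halg : ∀ k, IsAlgebraic ℚ (Complex.exp (z k))) :
    (∑ k, z k • (A k).map (algebraMap ℚ ℂ)).det ≠ 0 := by
  intro hdet
  have hentry : ∀ i j,
      IsAlgebraic ℚ (Complex.exp ((∑ k, z k • (A k).map (algebraMap ℚ ℂ)) i j)) :=
    fun i j => isAlgebraic_cexp_of_mem_logQSpan (sum_smul_map_mem_logQSpan halg A i j)
  obtain ⟨w, v, hw, hv, hsum⟩ := hMC _ hentry hdet
  rw [bilinear_sum_smul_eq] at hsum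
  have hcoef := Fintype.linearIndependent_iff.mp hz _ hsum
  rcases hA w v (fun k => hcoef k) with h | h
  · exact hw h
  · exact hv h

/-- Vacuous corollary in the format of piece D / the summit: under MC3, Schanuel's inequality at `n = 3`
holds at every `ℚ`-linearly independent triple of logarithms of algebraic numbers on such a cone (there
is none). [cite: DasguptaKakde2024, Conjecture 1.2] -/
theorem schanuel_ineq_on_cone_of_mc3 (hMC : MatrixCoefficientThree)
    (A : Fin 3 → Matrix (Fin 3) (Fin 3) ℚ)
    (hA : ∀ w v : Fin 3 → ℚ, (∀ k, ∑ i, ∑ j, w i * A k i j * v j = 0) → w = 0 ∨ v = 0)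
    (z : Fin 3 → ℂ) (hz : LinearIndependent ℚ z) (halg : ∀ k, IsAlgebraic ℚ (Complex.exp (z k)))
    (hcone : (∑ k, z k • (A k).map (algebraMap ℚ ℂ)).det = 0) :
    ((3 : ℕ) : Cardinal) ≤ Algebra.trdeg ℚ
      ↥(IntermediateField.adjoin ℚ (Set.range z ∪ Set.range (Complex.exp ∘ z))) :=
  absurd hcone (det_ne_zero_of_mc3 hMC A hA z hz halg)

/-! ## Exact reach: rational isotropic pairs = rational points of the cone -/

/-- If the cone `det (∑ xₖ Aₖ) = 0` has a non-zero RATIONAL point `x`, then `A` has a rational isotropic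
pair: take `v ≠ 0` in the kernel of `∑ xₖ Aₖ`; the three vectors `Aₖ v` satisfy the non-trivial relation
`∑ xₖ (Aₖ v) = 0`, so some `w ≠ 0` is orthogonal to all of them.  (On such tensors MC3's conclusion holds
trivially and the sieve is void — e.g. every cone over a plane cubic with a rational point.) [folklore] -/
theorem isotropicPair_of_ratPoint (A : Fin 3 → Matrix (Fin 3) (Fin 3) ℚ) (x : Fin 3 → ℚ)
    (hx : x ≠ 0) (hdet : (∑ k, x k • A k).det = 0) :
    ∃ w v : Fin 3 → ℚ, w ≠ 0 ∧ v ≠ 0 ∧ ∀ k, ∑ i, ∑ j, w i * A k i j * v j = 0 := by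
  obtain ⟨v, hv, hMv⟩ := Matrix.exists_mulVec_eq_zero_iff.2 hdet
  -- `C k i = (Aₖ v) i`; the relation `∑ₖ xₖ (Aₖ v) = (∑ xₖ Aₖ) v = 0` says `xᵗ C = 0`.
  have hxC : Matrix.vecMul x (Matrix.of fun k i => (A k).mulVec v i) = 0 := by
    funext i
    calc Matrix.vecMul x (Matrix.of fun k i => (A k).mulVec v i) i = (∑ k, x k • A k).mulVec v i := by
          simp only [Matrix.vecMul, Matrix.mulVec, dotProduct, Matrix.of_apply, Matrix.sum_apply,
            Matrix.smul_apply, smul_eq_mul, Finset.mul_sum, Finset.sum_mul]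
          exact Finset.sum_comm.trans
            (Finset.sum_congr rfl fun j _ => Finset.sum_congr rfl fun k _ => by ring)
      _ = 0 := by rw [hMv]; rfl
  have hCdet : (Matrix.of fun k i => (A k).mulVec v i).det = 0 :=
    Matrix.exists_vecMul_eq_zero_iff.1 ⟨x, hx, hxC⟩
  obtain ⟨w, hw, hCw⟩ := Matrix.exists_mulVec_eq_zero_iff.2 hCdet
  refine ⟨w, v, hw, hv, fun k => ?_⟩
  calc ∑ i, ∑ j, w i * A k i j * v j = (Matrix.of fun k i => (A k).mulVec v i).mulVec w k := by
        simp only [Matrix.mulVec, dotProduct, Matrix.of_apply, Finset.sum_mul]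
        exact Finset.sum_congr rfl fun i _ => Finset.sum_congr rfl fun j _ => by ring
    _ = 0 := by rw [hCw]; rfl

/-- Conversely, a rational isotropic pair `(w, v)` yields a non-zero rational point of the cone: the
three row vectors `wᵗ Aₖ` are orthogonal to `v ≠ 0`, hence linearly dependent, `∑ xₖ wᵗAₖ = 0` with
`x ≠ 0`, and then `wᵗ (∑ xₖ Aₖ) = 0` with `w ≠ 0` forces `det (∑ xₖ Aₖ) = 0`.  So the sieve reaches
EXACTLY the `ℚ`-determinantal cones without rational points. [folklore] -/
theorem ratPoint_of_isotropicPair (A : Fin 3 → Matrix (Fin 3) (Fin 3) ℚ) (w v : Fin 3 → ℚ)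
    (hw : w ≠ 0) (hv : v ≠ 0) (hiso : ∀ k, ∑ i, ∑ j, w i * A k i j * v j = 0) :
    ∃ x : Fin 3 → ℚ, x ≠ 0 ∧ (∑ k, x k • A k).det = 0 := by
  -- `R k j = (wᵗ Aₖ) j`; isotropy says `R v = 0`.
  have hRv : (Matrix.of fun k j => Matrix.vecMul w (A k) j).mulVec v = 0 := by
    funext k
    calc (Matrix.of fun k j => Matrix.vecMul w (A k) j).mulVec v k = ∑ i, ∑ j, w i * A k i j * v j := by
          simp only [Matrix.mulVec, Matrix.vecMul, dotProduct, Matrix.of_apply, Finset.sum_mul]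
          exact Finset.sum_comm
      _ = 0 := hiso k
  have hRdet : (Matrix.of fun k j => Matrix.vecMul w (A k) j).det = 0 :=
    Matrix.exists_mulVec_eq_zero_iff.1 ⟨v, hv, hRv⟩
  obtain ⟨x, hx, hxR⟩ := Matrix.exists_vecMul_eq_zero_iff.2 hRdet
  refine ⟨x, hx, Matrix.exists_vecMul_eq_zero_iff.1 ⟨w, hw, ?_⟩⟩
  funext j
  calc Matrix.vecMul w (∑ k, x k • A k) j
        = Matrix.vecMul x (Matrix.of fun k j => Matrix.vecMul w (A k) j) j := by
        simp only [Matrix.vecMul, dotProduct, Matrix.of_apply, Matrix.sum_apply, Matrix.smul_apply,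
          smul_eq_mul, Finset.mul_sum]
        exact Finset.sum_comm.trans
          (Finset.sum_congr rfl fun k _ => Finset.sum_congr rfl fun i _ => by ring)
    _ = 0 := by rw [hxR]; rfl

/-- Sharpness w.r.t. lens-1 g20: the symmetric congruent-number pencil
`[[X₂, 0, X₀], [0, −X₀, X₁], [X₀, X₁, X₂]]` of `RootDecomp1DeterminantalPlacement` (restated). -/
def congruentPencil : Fin 3 → Matrix (Fin 3) (Fin 3) ℚ :=
  ![!![0, 0, 1; 0, -1, 0; 1, 0, 0], !![0, 0, 0; 0, 0, 1; 0, 1, 0], !![1, 0, 0; 0, 0, 0; 0, 0, 1]]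

/-- The congruent-number pencil HAS a rational isotropic pair (`w = e₀`, `v = e₁`: its entry `(0,1)`
vanishes identically), so MC3 is void on g20's cell — as on every cone over a cubic with a rational
point (`isotropicPair_of_ratPoint`). [folklore] -/
theorem congruentPencil_isotropic :
    ∃ w v : Fin 3 → ℚ, w ≠ 0 ∧ v ≠ 0 ∧ ∀ k, ∑ i, ∑ j, w i * congruentPencil k i j * v j = 0 := by
  refine ⟨![1, 0, 0], ![0, 1, 0], ?_, ?_, fun k => ?_⟩
  · intro h; simpa using congrFun h 0
  · intro h; simpa using congrFun h 1
  · fin_cases k <;> simp [congruentPencil, Fin.sum_univ_three]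

/-! ## An explicit pointless cell: 2-adic descent -/

/-- `a³ + 2b³ + 4c³ + 8abc = 0` has only the trivial integer solution (descent at `2`: `a`, then `b`,
then `c` are even, and halving returns the same equation). [folklore] -/
theorem int_descent (a b c : ℤ) (h : a ^ 3 + 2 * b ^ 3 + 4 * c ^ 3 + 8 * (a * b * c) = 0) :
    a = 0 ∧ b = 0 ∧ c = 0 := by
  generalize hn : a.natAbs + b.natAbs + c.natAbs = n
  induction n using Nat.strong_induction_on generalizing a b c with
  | _ n ih =>
  have ha : Even a := by
    have h3 : Even (a ^ 3) := ⟨-b ^ 3 - 2 * c ^ 3 - 4 * (a * b * c), by linear_combination h⟩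
    exact (Int.even_pow.mp h3).1
  obtain ⟨a', rfl⟩ := ha
  have hb : Even b := by
    have h3 : Even (b ^ 3) := by
      refine ⟨-2 * a' ^ 3 - c ^ 3 - 4 * (a' * b * c), ?_⟩
      have h2 : (2 : ℤ) * b ^ 3 =
          2 * (-2 * a' ^ 3 - c ^ 3 - 4 * (a' * b * c) + (-2 * a' ^ 3 - c ^ 3 - 4 * (a' * b * c))) := by
        linear_combination h
      exact mul_left_cancel₀ two_ne_zero h2
    exact (Int.even_pow.mp h3).1
  obtain ⟨b', rfl⟩ := hb
  have hc : Even c := by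
    have h3 : Even (c ^ 3) := by
      refine ⟨-a' ^ 3 - 2 * b' ^ 3 - 4 * (a' * b' * c), ?_⟩
      have h4 : (4 : ℤ) * c ^ 3 =
          4 * (-a' ^ 3 - 2 * b' ^ 3 - 4 * (a' * b' * c) + (-a' ^ 3 - 2 * b' ^ 3 - 4 * (a' * b' * c))) := by
        linear_combination h
      exact mul_left_cancel₀ four_ne_zero h4
    exact (Int.even_pow.mp h3).1
  obtain ⟨c', rfl⟩ := hc
  have h' : a' ^ 3 + 2 * b' ^ 3 + 4 * c' ^ 3 + 8 * (a' * b' * c') = 0 := by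
    have h8 : (8 : ℤ) * (a' ^ 3 + 2 * b' ^ 3 + 4 * c' ^ 3 + 8 * (a' * b' * c')) = 8 * 0 := by
      linear_combination h
    exact mul_left_cancel₀ (by norm_num) h8
  have e : ∀ x : ℤ, (x + x).natAbs = 2 * x.natAbs := fun x => by
    rw [← two_mul, Int.natAbs_mul]; rfl
  rw [e, e, e] at hn
  rcases Nat.eq_zero_or_pos (a'.natAbs + b'.natAbs + c'.natAbs) with h0 | hpos
  · have ha0 : a' = 0 := Int.natAbs_eq_zero.mp (by omega)
    have hb0 : b' = 0 := Int.natAbs_eq_zero.mp (by omega)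
    have hc0 : c' = 0 := Int.natAbs_eq_zero.mp (by omega)
    subst ha0 hb0 hc0
    simp
  · obtain ⟨h1, h2, h3⟩ := ih (a'.natAbs + b'.natAbs + c'.natAbs) (by omega) a' b' c' h' rfl
    subst h1 h2 h3
    simp

/-- Rational version: `p³ + 2q³ + 4r³ + 8pqr = 0` over `ℚ` forces `p = q = r = 0` (clear denominators,
then `int_descent`).  Equivalently: the smooth plane cubic `x³ + 2y³ + 4z³ + 8xyz = 0` has no rational
point. [folklore] -/
theorem rat_descent (p q r : ℚ) (h : p ^ 3 + 2 * q ^ 3 + 4 * r ^ 3 + 8 * (p * q * r) = 0) :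
    p = 0 ∧ q = 0 ∧ r = 0 := by
  have hp : (p.num : ℚ) = p * p.den := (Rat.mul_den_eq_num p).symm
  have hq : (q.num : ℚ) = q * q.den := (Rat.mul_den_eq_num q).symm
  have hr : (r.num : ℚ) = r * r.den := (Rat.mul_den_eq_num r).symm
  have hint : (p.num * (q.den * r.den)) ^ 3 + 2 * (q.num * (p.den * r.den)) ^ 3 +
      4 * (r.num * (p.den * q.den)) ^ 3 +
      8 * (p.num * (q.den * r.den) * (q.num * (p.den * r.den)) * (r.num * (p.den * q.den))) = 0 := by
    have hQ : (((p.num * (q.den * r.den)) ^ 3 + 2 * (q.num * (p.den * r.den)) ^ 3 +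
        4 * (r.num * (p.den * q.den)) ^ 3 +
        8 * (p.num * (q.den * r.den) * (q.num * (p.den * r.den)) * (r.num * (p.den * q.den))) : ℤ) : ℚ)
        = 0 := by
      push_cast
      rw [hp, hq, hr]
      linear_combination ((p.den : ℚ) * q.den * r.den) ^ 3 * h
    exact_mod_cast hQ
  obtain ⟨ha0, hb0, hc0⟩ := int_descent _ _ _ hint
  have hpd : (p.den : ℤ) ≠ 0 := by exact_mod_cast p.den_nz
  have hqd : (q.den : ℤ) ≠ 0 := by exact_mod_cast q.den_nz
  have hrd : (r.den : ℤ) ≠ 0 := by exact_mod_cast r.den_nz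
  refine ⟨Rat.num_eq_zero.mp ?_, Rat.num_eq_zero.mp ?_, Rat.num_eq_zero.mp ?_⟩
  · exact (mul_eq_zero.mp ha0).resolve_right (mul_ne_zero hqd hrd)
  · exact (mul_eq_zero.mp hb0).resolve_right (mul_ne_zero hpd hrd)
  · exact (mul_eq_zero.mp hc0).resolve_right (mul_ne_zero hpd hqd)

/-! ## The explicit pointless `ℚ`-determinantal elliptic cone -/

/-- The pencil `L(X) = X₀A₀ + X₁A₁ + X₂A₂ = [[X₀, X₁, X₂], [X₂, −X₀, −2X₁], [X₁, 4X₂, X₀]]`. -/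
def sievePencil : Fin 3 → Matrix (Fin 3) (Fin 3) ℚ :=
  ![!![1, 0, 0; 0, -1, 0; 0, 0, 1], !![0, 1, 0; 0, 0, -2; 1, 0, 0], !![0, 0, 1; 1, 0, 0; 0, 4, 0]]

/-- The member of the pencil at `z ∈ ℂ³`, entrywise. -/
theorem sum_smul_sievePencil_eq (z : Fin 3 → ℂ) :
    ∑ k, z k • (sievePencil k).map (algebraMap ℚ ℂ) =
      !![z 0, z 1, z 2; z 2, -z 0, -2 * z 1; z 1, 4 * z 2, z 0] := by
  ext i j
  fin_cases i <;> fin_cases j <;>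
    simp [sievePencil, Fin.sum_univ_three, Matrix.sum_apply] <;> ring

/-- `det L(z) = −z₀³ − 2z₁³ + 4z₂³ + 8z₀z₁z₂` — the cone over the smooth plane cubic
`x³ + 2y³ − 4z³ − 8xyz = 0` (smooth: `(−8)³ ≠ −27·1·2·(−4)`; no rational point: 2-adic descent). -/
theorem det_sievePencil (z : Fin 3 → ℂ) :
    (∑ k, z k • (sievePencil k).map (algebraMap ℚ ℂ)).det =
      -z 0 ^ 3 - 2 * z 1 ^ 3 + 4 * z 2 ^ 3 + 8 * (z 0 * z 1 * z 2) := by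
  rw [sum_smul_sievePencil_eq, Matrix.det_fin_three]
  simp
  ring

/-- The rational pencil itself, entrywise (rational points of the cone live here). -/
theorem sum_smul_sievePencil_eq_rat (x : Fin 3 → ℚ) :
    ∑ k, x k • sievePencil k = !![x 0, x 1, x 2; x 2, -x 0, -2 * x 1; x 1, 4 * x 2, x 0] := by
  ext i j
  fin_cases i <;> fin_cases j <;>
    simp [sievePencil, Fin.sum_univ_three, Matrix.sum_apply] <;> ring

/-- The ISOTROPY FACE of the tensor: `N(w)ₖⱼ = ∑ᵢ wᵢ (Aₖ)ᵢⱼ`, so that `wᵗ Aₖ v = (N(w) v)ₖ`. -/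
def isoFace (w : Fin 3 → ℚ) : Matrix (Fin 3) (Fin 3) ℚ :=
  !![w 0, -w 1, w 2; w 2, w 0, -2 * w 1; w 1, 4 * w 2, w 0]

/-- Matrix–vector form of the isotropy face `isoFace`. -/
theorem isoFace_mulVec (w v : Fin 3 → ℚ) (k : Fin 3) :
    (isoFace w).mulVec v k = ∑ i, ∑ j, w i * sievePencil k i j * v j := by
  fin_cases k <;>
    simp [isoFace, sievePencil, Matrix.mulVec, dotProduct, Fin.sum_univ_three] <;> ring

/-- `det N(w) = G(w) = w₀³ + 2w₁³ + 4w₂³ + 8w₀w₁w₂` — again a smooth cubic (`8³ ≠ −27·1·2·4`) with no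
rational point (`rat_descent`). -/
theorem det_isoFace (w : Fin 3 → ℚ) :
    (isoFace w).det = w 0 ^ 3 + 2 * w 1 ^ 3 + 4 * w 2 ^ 3 + 8 * (w 0 * w 1 * w 2) := by
  rw [isoFace, Matrix.det_fin_three]
  simp
  ring

/-- **The explicit tensor has no rational isotropic pair**: `wᵗ Aₖ v = 0` for `k = 0, 1, 2` means
`N(w) v = 0`; if `v ≠ 0` then `G(w) = det N(w) = 0`, so `w = 0` by descent. [folklore] -/
theorem no_isotropic_pair_sievePencil (w v : Fin 3 → ℚ)
    (h : ∀ k, ∑ i, ∑ j, w i * sievePencil k i j * v j = 0) : w = 0 ∨ v = 0 := by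
  by_cases hv : v = 0
  · exact Or.inr hv
  left
  have hmul : (isoFace w).mulVec v = 0 := by
    funext k
    rw [isoFace_mulVec]
    exact h k
  have hdet : (isoFace w).det = 0 := Matrix.exists_mulVec_eq_zero_iff.1 ⟨v, hv, hmul⟩
  rw [det_isoFace] at hdet
  obtain ⟨h0, h1, h2⟩ := rat_descent _ _ _ hdet
  funext k
  fin_cases k
  · exact h0
  · exact h1
  · exact h2

/-- Hence the cone itself has no non-zero rational point (contrapositive of `isotropicPair_of_ratPoint`):
`−x₀³ − 2x₁³ + 4x₂³ + 8x₀x₁x₂ = 0` over `ℚ` forces `x = 0`. [folklore] -/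
theorem sieveCone_no_ratPoint (x : Fin 3 → ℚ)
    (hx : -x 0 ^ 3 - 2 * x 1 ^ 3 + 4 * x 2 ^ 3 + 8 * (x 0 * x 1 * x 2) = 0) : x = 0 := by
  by_contra hne
  have hdet : (∑ k, x k • sievePencil k).det = 0 := by
    rw [sum_smul_sievePencil_eq_rat, Matrix.det_fin_three]
    simp
    linear_combination hx
  obtain ⟨w, v, hw, hv, hiso⟩ := isotropicPair_of_ratPoint sievePencil x hne hdet
  rcases no_isotropic_pair_sievePencil w v hiso with h | h
  · exact hw h
  · exact hv h

/-- **MC3 empties the explicit cell of the v4 first stratum.**  Under `MatrixCoefficientThree`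
(stmt-Schanuel-15346), no `ℚ`-linearly independent triple of logarithms of algebraic numbers lies on the
elliptic cone `−z₀³ − 2z₁³ + 4z₂³ + 8z₀z₁z₂ = 0`; piece D (stmt-Schanuel-30353) holds on this cell
vacuously. [cite: DasguptaKakde2024, Conjecture 1.2] -/
theorem sieveCone_free_of_mc3 (hMC : MatrixCoefficientThree)
    (z : Fin 3 → ℂ) (hz : LinearIndependent ℚ z) (halg : ∀ k, IsAlgebraic ℚ (Complex.exp (z k))) :
    -z 0 ^ 3 - 2 * z 1 ^ 3 + 4 * z 2 ^ 3 + 8 * (z 0 * z 1 * z 2) ≠ 0 := by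
  rw [← det_sievePencil]
  exact det_ne_zero_of_mc3 hMC sievePencil no_isotropic_pair_sievePencil z hz halg

/-- Vacuous corollary in the summit's format: under MC3, Schanuel's inequality at `n = 3` holds at every
`ℚ`-linearly independent triple of logarithms of algebraic numbers on the cone (there is none).
[cite: DasguptaKakde2024, Conjecture 1.2] -/
theorem schanuel_ineq_on_sieveCone_of_mc3 (hMC : MatrixCoefficientThree)
    (z : Fin 3 → ℂ) (hz : LinearIndependent ℚ z) (halg : ∀ k, IsAlgebraic ℚ (Complex.exp (z k)))
    (hcone : -z 0 ^ 3 - 2 * z 1 ^ 3 + 4 * z 2 ^ 3 + 8 * (z 0 * z 1 * z 2) = 0) :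
    ((3 : ℕ) : Cardinal) ≤ Algebra.trdeg ℚ
      ↥(IntermediateField.adjoin ℚ (Set.range z ∪ Set.range (Complex.exp ∘ z))) :=
  absurd hcone (sieveCone_free_of_mc3 hMC z hz halg)

/-- **S-side pin.**  Schanuel's conjecture empties the same cell (through `AlgIndepLogarithms`, tree
`algIndepLogarithms_of_schanuel`: a `ℚ`-linearly independent triple in `𝓛` is algebraically independent,
and the cubic form is a non-zero polynomial — it takes the value `−1` at `(1, 0, 0)`).  So the statement
decided modulo MC3 is a consequence of the summit (on-path). [cite: Waldschmidt2005, §1 Conjecture 1.1] -/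
theorem sieveCone_free_of_schanuel (hS : _root_.Schanuel)
    (z : Fin 3 → ℂ) (hz : LinearIndependent ℚ z) (halg : ∀ k, IsAlgebraic ℚ (Complex.exp (z k))) :
    -z 0 ^ 3 - 2 * z 1 ^ 3 + 4 * z 2 ^ 3 + 8 * (z 0 * z 1 * z 2) ≠ 0 := by
  intro hF
  have hAI : AlgebraicIndependent ℚ z := algIndepLogarithms_of_schanuel (fun n => hS n) 3 z halg hz
  set P : MvPolynomial (Fin 3) ℚ :=
    -MvPolynomial.X 0 ^ 3 - 2 * MvPolynomial.X 1 ^ 3 + 4 * MvPolynomial.X 2 ^ 3 +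
      8 * (MvPolynomial.X 0 * MvPolynomial.X 1 * MvPolynomial.X 2) with hP
  have haeval : MvPolynomial.aeval z P =
      -z 0 ^ 3 - 2 * z 1 ^ 3 + 4 * z 2 ^ 3 + 8 * (z 0 * z 1 * z 2) := by
    simp [hP, map_add, map_sub, map_neg, map_mul, map_pow]
  have hP0 : P = 0 := algebraicIndependent_iff.mp hAI P (haeval.trans hF)
  have h100 : MvPolynomial.eval ![(1 : ℚ), 0, 0] P = -1 := by
    simp [hP]
  rw [hP0, map_zero] at h100
  norm_num at h100

end Summit.Schanuel.Schanuel.Theorems.RootDecomp1IsotropySieve
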